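import Summits.PneNP.PneNP.Theses.ReslinMediumCover
import Summits.PneNP.PneNP.Theorems.ReslinMediumCoverManyMediumLinesCritDensity

/-!
# PneNP / ReslinMediumCover — the crux `ManyMediumLines` REDUCES to the medium-cover stub MC
(composition of the birth skeleton with stubs BL and CD discharged; crux stmt-PneNP-19698)

Route `PneNP/ReslinMediumCover`, crux `Summit.PneNP.PneNP.Theses.ReslinMediumCover.ManyMediumLines`
(open problem; NOT claimed, NOT closed here). The crux's bottleneck-counting skeleton has three stubs:
MC (medium cover), BL (boundary law), CD (critical density). BL and CD are theorems of this route's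
Theorems files (`card_falsifiers_le_of_connected`, `card_critAt`). This file proves the COMPOSITION
with those two discharged: `ManyMediumLines` follows from the medium-cover statement ALONE, stated here
as an explicit hypothesis (no definition, no named fact):

  MC: for every `η > 1` and `ε > 0`, for all large `N`, every connected `G` on `Fin N` whose medium sets
  have `≥ ηN` boundary edges, every odd charge `c` and every Res(⊕) refutation `π` of `τ(G, c) ∘ MAJ₃`:
  the critical assignments falsified by at least one line of `π` of MEDIUM critical support number at
  least `2^{-εN} · |Crit|` (`Crit` = all critical assignments).

Arithmetic of the composition (`manyMediumLines_of_mediumCover`): with `M` the set of distinct medium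
clauses of `π`, `2^{-εN}|Crit| ≤ |covered| ≤ Σ_{C ∈ M} |falsifiers C| ≤ |M| · 2^{3N² - ηN - 1}` (BL) and
`|Crit| ≥ |critAt u₀| = 2^{3N² - N + 1}` (CD), so `|M| ≥ 2^{(η - 1 - ε)N + 2}`; `ε = (η - 1)/2` gives the
crux's `2^{(η-1)N/2}`. MC is the wall of the route ("a dag may reuse few medium lines for most critical
assignments"); nothing here bears on it.

References: S. Jukna, *Boolean Function Complexity* (2012), §18.4 and Thm 18.17 (bottleneck counting);
A. Urquhart, J. ACM 34 (1987), §4.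
-/

namespace Summit.PneNP.PneNP.Theorems

-- `Summit.PneNP.PneNP` repeats a path component by design (summit = sub-problem); silence the linter.
set_option linter.dupNamespace false

namespace ResLinBoundaryLaw

open Finset Literature.Computability.Complexity Literature.Computability.MetaComplexity

/-- **The crux `ManyMediumLines` reduces to the medium-cover statement MC** (the composition of the
counting skeleton with the boundary law and the critical density discharged). The hypothesis is the
medium-cover stub stated verbatim as a hypothesis; the conclusion is the route's crux decl. -/
theorem manyMediumLines_of_mediumCover
    (hMC : ∀ η : ℝ, 1 < η → ∀ ε : ℝ, 0 < ε → ∃ N₁ : ℕ, ∀ N ≥ N₁,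
      ∀ (G : SimpleGraph (Fin N)) [DecidableRel G.Adj], G.Connected →
      (∀ U : Finset (Fin N), (N + 7) / 8 < U.card → U.card + (N + 7) / 8 < N →
        η * N ≤ ((edgeCut G U).card : ℝ)) →
      ∀ c : Fin N → Bool, Odd (Finset.univ.filter fun u => c u = true).card →
      ∀ π : List ResLinLine, IsResLinRefutation (tseitinMaj G c) π →
        (2 : ℝ) ^ (-(ε * N)) * (((Finset.univ : Finset (Fin N)).biUnion (critAt G c)).card : ℝ) ≤
          ((((Finset.univ : Finset (Fin N)).biUnion (critAt G c)).filter fun x =>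
            ∃ C ∈ ((π.map ResLinLine.clause).toFinset.filter fun C =>
                (N + 7) / 8 < (critSupport G c C).card ∧ (critSupport G c C).card + (N + 7) / 8 < N),
              C.eval (pad x) = false).card : ℝ)) :
    Summit.PneNP.PneNP.Theses.ReslinMediumCover.ManyMediumLines := by
  intro η hη
  classical
  have hε : (0 : ℝ) < (η - 1) / 2 := by linarith
  obtain ⟨N₁, hN₁⟩ := hMC η hη ((η - 1) / 2) hε
  refine ⟨max N₁ 1, fun N hN G _ hconn hexp c hodd π hπ => ?_⟩
  have hN1 : 1 ≤ N := le_trans (le_max_right _ _) hN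
  have hNN₁ : N₁ ≤ N := le_trans (le_max_left _ _) hN
  -- notation
  set M := ((π.map ResLinLine.clause).toFinset.filter fun C =>
    (N + 7) / 8 < (critSupport G c C).card ∧ (critSupport G c C).card + (N + 7) / 8 < N) with hM
  set Crit := (Finset.univ : Finset (Fin N)).biUnion (critAt G c) with hCrit
  set Cov := Crit.filter (fun x => ∃ C ∈ M, C.eval (pad x) = false) with hCov
  have two_pos : (0 : ℝ) < 2 := by norm_num
  have cast_pow : ∀ k : ℕ, ((2 ^ k : ℕ) : ℝ) = (2 : ℝ) ^ (k : ℝ) := fun k => by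
    rw [Real.rpow_natCast]; push_cast; rfl
  -- (1) the medium-cover hypothesis
  have hmc : (2 : ℝ) ^ (-((η - 1) / 2 * N)) * (Crit.card : ℝ) ≤ (Cov.card : ℝ) :=
    hN₁ N hNN₁ G hconn hexp c hodd π hπ
  -- (2) union bound: the covered critical assignments lie in the falsifier sets of the medium clauses
  have hunion : Cov.card ≤ ∑ C ∈ M, (Finset.univ.filter fun x : Fin (3 * N ^ 2) → Bool =>
      C.eval (pad x) = false).card := by
    refine le_trans (Finset.card_le_card ?_) Finset.card_biUnion_le
    intro x hx
    rw [hCov, Finset.mem_filter] at hx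
    obtain ⟨-, C, hC, hfalse⟩ := hx
    rw [Finset.mem_biUnion]
    exact ⟨C, hC, Finset.mem_filter.mpr ⟨Finset.mem_univ _, hfalse⟩⟩
  -- (3) boundary law for each medium clause: `|falsifiers| ≤ 2^{3N²} · 2^{-ηN - 1}`
  have hBL : ∀ C ∈ M, ((Finset.univ.filter fun x : Fin (3 * N ^ 2) → Bool =>
      C.eval (pad x) = false).card : ℝ) ≤ (2 : ℝ) ^ ((3 * N ^ 2 : ℕ) : ℝ) * (2 : ℝ) ^ (-(η * N) - 1) := by
    intro C hC
    rw [hM, Finset.mem_filter] at hC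
    obtain ⟨-, h1, h2⟩ := hC
    set S := critSupport G c C with hS
    have hSne : S.Nonempty := Finset.card_pos.mp (by omega)
    have hSnu : S ≠ Finset.univ := by
      intro h
      rw [h, Finset.card_univ, Fintype.card_fin] at h2
      omega
    have hbl := card_falsifiers_le_of_connected G c hconn C hSne hSnu
    rw [Nat.card_eq_fintype_card, Fintype.card_subtype] at hbl
    -- the boundary of the medium set `S`
    have hd : η * N ≤ ((edgeCut G S).card : ℝ) := hexp S h1 h2
    have hdle : (edgeCut G S).card + 1 ≤ 3 * N ^ 2 := by
      have h3 : (edgeCut G S).card ≤ G.edgeFinset.card :=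
        Finset.card_le_card (Finset.filter_subset _ _)
      have h4 := SimpleGraph.card_edgeFinset_le_card_choose_two (G := G)
      rw [Fintype.card_fin, Nat.choose_two_right] at h4
      have h5 : N * (N - 1) / 2 < 3 * N ^ 2 := by
        calc N * (N - 1) / 2 ≤ N * (N - 1) := Nat.div_le_self _ _
          _ ≤ N * N := Nat.mul_le_mul_left N (Nat.sub_le N 1)
          _ < 3 * N ^ 2 := by nlinarith
      omega
    calc ((Finset.univ.filter fun x : Fin (3 * N ^ 2) → Bool => C.eval (pad x) = false).card : ℝ)
        ≤ ((2 ^ (3 * N ^ 2 - ((edgeCut G S).card + 1)) : ℕ) : ℝ) := by exact_mod_cast hbl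
      _ = (2 : ℝ) ^ (((3 * N ^ 2 : ℕ) : ℝ) - ((edgeCut G S).card + 1)) := by
          rw [cast_pow, Nat.cast_sub hdle]
          push_cast
          ring_nf
      _ ≤ (2 : ℝ) ^ (((3 * N ^ 2 : ℕ) : ℝ) + (-(η * N) - 1)) := by
          apply Real.rpow_le_rpow_of_exponent_le (by norm_num)
          linarith
      _ = (2 : ℝ) ^ ((3 * N ^ 2 : ℕ) : ℝ) * (2 : ℝ) ^ (-(η * N) - 1) := Real.rpow_add two_pos _ _
  -- hence `|Cov| ≤ |M| · 2^{3N²} · 2^{-ηN-1}`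
  have hcov_le : (Cov.card : ℝ) ≤ (M.card : ℝ) * ((2 : ℝ) ^ ((3 * N ^ 2 : ℕ) : ℝ) *
      (2 : ℝ) ^ (-(η * N) - 1)) := by
    calc (Cov.card : ℝ) ≤ ((∑ C ∈ M, (Finset.univ.filter fun x : Fin (3 * N ^ 2) → Bool =>
          C.eval (pad x) = false).card : ℕ) : ℝ) := by exact_mod_cast hunion
      _ = ∑ C ∈ M, ((Finset.univ.filter fun x : Fin (3 * N ^ 2) → Bool =>
          C.eval (pad x) = false).card : ℝ) := by push_cast; rfl
      _ ≤ ∑ C ∈ M, (2 : ℝ) ^ ((3 * N ^ 2 : ℕ) : ℝ) * (2 : ℝ) ^ (-(η * N) - 1) :=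
          Finset.sum_le_sum hBL
      _ = (M.card : ℝ) * ((2 : ℝ) ^ ((3 * N ^ 2 : ℕ) : ℝ) * (2 : ℝ) ^ (-(η * N) - 1)) := by
          rw [Finset.sum_const, nsmul_eq_mul]
  -- (4) critical density: `|Crit| ≥ |critAt u₀| = 2^{3N²} · 2^{1 - N}`
  have hcrit : (2 : ℝ) ^ ((3 * N ^ 2 : ℕ) : ℝ) * (2 : ℝ) ^ (1 - (N : ℝ)) ≤ (Crit.card : ℝ) := by
    let u₀ : Fin N := ⟨0, hN1⟩
    have hsub : critAt G c u₀ ⊆ Crit := Finset.subset_biUnion_of_mem (critAt G c) (Finset.mem_univ u₀)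
    have hcd := card_critAt G c hconn hodd u₀
    have hNle : N ≤ 3 * N ^ 2 := by nlinarith
    calc (2 : ℝ) ^ ((3 * N ^ 2 : ℕ) : ℝ) * (2 : ℝ) ^ (1 - (N : ℝ))
        = (2 : ℝ) ^ (((3 * N ^ 2 : ℕ) : ℝ) + (1 - (N : ℝ))) := (Real.rpow_add two_pos _ _).symm
      _ = (((2 ^ (3 * N ^ 2 - N + 1) : ℕ)) : ℝ) := by
          rw [cast_pow, Nat.cast_add, Nat.cast_sub hNle]
          push_cast
          ring_nf
      _ = ((critAt G c u₀).card : ℝ) := by rw [hcd]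
      _ ≤ (Crit.card : ℝ) := by exact_mod_cast Finset.card_le_card hsub
  -- (5) combine
  have hA : (0 : ℝ) < (2 : ℝ) ^ ((3 * N ^ 2 : ℕ) : ℝ) := Real.rpow_pos_of_pos two_pos _
  have hB : (0 : ℝ) < (2 : ℝ) ^ (-(η * N) - 1) := Real.rpow_pos_of_pos two_pos _
  have hE : (0 : ℝ) < (2 : ℝ) ^ (-((η - 1) / 2 * N)) := Real.rpow_pos_of_pos two_pos _
  -- `2^{-εN} · 2^{3N²} · 2^{1-N} ≤ |M| · 2^{3N²} · 2^{-ηN-1}`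
  have hchain : (2 : ℝ) ^ (-((η - 1) / 2 * N)) * ((2 : ℝ) ^ ((3 * N ^ 2 : ℕ) : ℝ) *
      (2 : ℝ) ^ (1 - (N : ℝ))) ≤ (M.card : ℝ) * ((2 : ℝ) ^ ((3 * N ^ 2 : ℕ) : ℝ) *
      (2 : ℝ) ^ (-(η * N) - 1)) :=
    le_trans (le_trans (mul_le_mul_of_nonneg_left hcrit hE.le) hmc) hcov_le
  -- divide: `|M| ≥ 2^{-εN} · 2^{1-N} / 2^{-ηN-1} = 2^{(η-1)N/2 + 2}`
  have hMge : (2 : ℝ) ^ ((η - 1) * N / 2 + 2) ≤ (M.card : ℝ) := by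
    have hq : (2 : ℝ) ^ ((η - 1) * N / 2 + 2) * ((2 : ℝ) ^ ((3 * N ^ 2 : ℕ) : ℝ) *
        (2 : ℝ) ^ (-(η * N) - 1)) = (2 : ℝ) ^ (-((η - 1) / 2 * N)) *
        ((2 : ℝ) ^ ((3 * N ^ 2 : ℕ) : ℝ) * (2 : ℝ) ^ (1 - (N : ℝ))) := by
      rw [← Real.rpow_add two_pos, ← Real.rpow_add two_pos, ← Real.rpow_add two_pos,
        ← Real.rpow_add two_pos]
      congr 1
      ring
    have := hchain
    rw [← hq] at this
    exact le_of_mul_le_mul_right this (mul_pos hA hB)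
  calc (2 : ℝ) ^ ((η - 1) * N / 2) ≤ (2 : ℝ) ^ ((η - 1) * N / 2 + 2) :=
        Real.rpow_le_rpow_of_exponent_le (by norm_num) (by linarith)
    _ ≤ (M.card : ℝ) := hMge

end ResLinBoundaryLaw

end Summit.PneNP.PneNP.Theorems
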